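import Literature.NumberTheory.LFunctions.ExceptionalPrimesMainTerm
import Literature.NumberTheory.LFunctions.MertensFormula
import HarnessLib

/-!
# Exceptional primes in one window `(q^{a'}, q^{a}]`: the `m`-fold product bound

Topic `Literature/NumberTheory/LFunctions`. Everything in this file is PROVED (theorems only);
sixth support file of the elementary proof of Heath-Brown's lemma on exceptional primes
(`ExceptionalPrimesSparse.lean`). For a multiplicative weight `g ≥ 0` with
`g(p^k) ≤ (k+1) (p^{-β})^k` at prime powers (in the application `g(n) = (1∗χ)(n) n^{-β}`), a
modulus `q` with `q^{4(1−β)} ≤ 1.01`, and a window of primes `W = {q^{a'} < p ≤ q^{a}}` with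
`a ≤ 4`, `a ≤ 1.1 a'`, `a' log q ≥ 320`, and an integer `m ≥ 2` with `a' m ≥ 4`, `a m ≤ 9`:

* `sum_inv_prime_window_le` — Mertens: `∑_{p ∈ W} 1/p ≤ log log q^a − log log q^{a'} + 16/(a' log q)`
  (the tree's `Literature.NumberTheory.LFunctions.Mertens.abs_primeRecipSum_sub_le`);
* `sum_prime_pow_weight_le` — `∑_{1 ≤ k ≤ Y} g(p^k) ≤ 2.05/p` for `p ≥ 321` with `p^{-β} ≤ 1.01/p`;
* `window_sum_le` — if the weight in `(q^4, q^{13}]` is at most `ρ₁` times the weight in `[1, q^4]`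
  (`ExceptionalPrimesMainTerm.lean`: `ρ₁ ≍ 1/η`), then
  `∑_{p ∈ W} g(p) ≤ m (2ρ₁)^{1/m} + (m − 1) · 2.02 q^{−a'}`.
  Proof: the integers `n ≤ q^4` free of `W` carry at least half the weight (one-prime sieve,
  `τ = ∑_{p∈W} ∑_k g(p^k) ≤ 2.05 · 0.15 < 1/2`), the products `n ∏ P` over `m`-subsets `P ⊆ W`
  lie in `(q^4, q^{13}]` and are distinct, so `e_m(g; W) ≤ 2ρ₁`, and `sum_le_of_esymm_le`.
  This is Tao–Teräväinen's (3.14) with the injectivity repaired and explicit constants.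

## References

* T. Tao, J. Teräväinen, *The Hardy–Littlewood–Chowla conjecture in the presence of a Siegel
  zero*, J. London Math. Soc. 106 (2022), §3.3, Proposition 3.5 (3.14). [TaoTeravainen2021]
* G. H. Hardy, E. M. Wright, *An Introduction to the Theory of Numbers*, Thm 427. [HardyWright2008]
-/

noncomputable section

open Finset ArithmeticFunction
open Literature.NumberTheory.LFunctions.Mertens

namespace Literature.NumberTheory.LFunctions.SiegelZero

/-! ### Mertens in a window -/

/-- The primes of `(t', t]` as a difference of two initial segments: for `0 ≤ t' ≤ t`,
`∑_{p ≤ t, t' < p} h(p) = ∑_{p ≤ t} h(p) − ∑_{p ≤ t'} h(p)`. [folklore] -/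
theorem sum_primesLE_filter_lt_eq_sub (h : ℕ → ℝ) {t t' : ℝ} (ht' : 0 ≤ t') (htt : t' ≤ t) :
    ∑ p ∈ (Nat.primesLE ⌊t⌋₊).filter (fun p : ℕ => t' < (p : ℝ)), h p =
      ∑ p ∈ Nat.primesLE ⌊t⌋₊, h p - ∑ p ∈ Nat.primesLE ⌊t'⌋₊, h p := by
  have hsplit := Finset.sum_filter_add_sum_filter_not (Nat.primesLE ⌊t⌋₊) (fun p : ℕ => t' < (p : ℝ)) h
  have hset : (Nat.primesLE ⌊t⌋₊).filter (fun p : ℕ => ¬ t' < (p : ℝ)) = Nat.primesLE ⌊t'⌋₊ := by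
    ext p
    simp only [Finset.mem_filter, Nat.mem_primesLE, not_lt]
    constructor
    · rintro ⟨⟨-, hp⟩, hpt'⟩
      exact ⟨Nat.le_floor hpt', hp⟩
    · rintro ⟨hpt', hp⟩
      have h1 : (p : ℝ) ≤ t' := (Nat.le_floor_iff ht').mp hpt'
      exact ⟨⟨Nat.le_floor (h1.trans htt), hp⟩, h1⟩
  rw [hset] at hsplit
  linarith

/-- **Mertens' second theorem in a window**: for `2 ≤ t' ≤ t`,
`∑_{t' < p ≤ t} 1/p ≤ log log t − log log t' + 8/log t + 8/log t'`.
[cite: HardyWright2008, Thm 427 (§22.7)] -/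
theorem sum_inv_prime_window_le {t t' : ℝ} (ht' : 2 ≤ t') (htt : t' ≤ t) :
    ∑ p ∈ (Nat.primesLE ⌊t⌋₊).filter (fun p : ℕ => t' < (p : ℝ)), (p : ℝ)⁻¹ ≤
      Real.log (Real.log t) - Real.log (Real.log t') + 8 / Real.log t + 8 / Real.log t' := by
  rw [sum_primesLE_filter_lt_eq_sub _ (by linarith) htt]
  have h1 := abs_primeRecipSum_sub_le (le_trans ht' htt)
  have h2 := abs_primeRecipSum_sub_le ht'
  unfold primeRecipSum at h1 h2
  rw [abs_le] at h1 h2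
  linarith [h1.2, h2.1]

/-! ### The weight of the powers of one prime -/

/-- **`∑_{1 ≤ k ≤ Y} g(p^k) ≤ 2.05/p`** when `g(p^k) ≤ (k+1) (p^{-β})^k`, `p^{-β} ≤ 1.01/p` and
`p ≥ 321`: `(k+1) y₀^k ≤ (2y₀)^k`, a geometric series with ratio `y = 2y₀ ≤ 2.02/321`, and
`y/(1−y) ≤ y(1 + 2y)`. [folklore] -/
theorem sum_prime_pow_weight_le {g : ArithmeticFunction ℝ} {p : ℕ} {β : ℝ} (Y : ℕ)
    (hgpk : ∀ k : ℕ, 1 ≤ k → g (p ^ k) ≤ (k + 1 : ℝ) * ((p : ℝ) ^ (-β)) ^ k)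
    (hp : (321 : ℝ) ≤ p) (hy : (p : ℝ) ^ (-β) ≤ 101 / 100 / p) :
    ∑ k ∈ Icc 1 Y, g (p ^ k) ≤ 205 / 100 / p := by
  set y₀ : ℝ := (p : ℝ) ^ (-β) with hy₀
  have hp0 : (0 : ℝ) < p := by linarith
  have hy₀0 : 0 ≤ y₀ := Real.rpow_nonneg hp0.le _
  have hy₀le : y₀ ≤ 101 / 100 / p := hy
  set y : ℝ := 2 * y₀ with hydef
  have hy0 : 0 ≤ y := by positivity
  have hyle : y ≤ 202 / 100 / p := by
    have e : (202 / 100 / p : ℝ) = 2 * (101 / 100 / p) := by ring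
    rw [hydef, e]; linarith
  have hysmall : y ≤ 202 / 100 / 321 := hyle.trans (div_le_div_of_nonneg_left (by norm_num) (by norm_num) hp)
  have hy1 : y < 1 := by linarith
  -- termwise: `g(p^k) ≤ (k+1) y₀^k ≤ (2 y₀)^k`
  have hterm : ∀ k ∈ Icc 1 Y, g (p ^ k) ≤ y ^ k := by
    intro k hk
    have hk1 : 1 ≤ k := (Finset.mem_Icc.mp hk).1
    refine (hgpk k hk1).trans ?_
    rw [hydef, mul_pow]
    apply mul_le_mul_of_nonneg_right _ (pow_nonneg hy₀0 k)
    have : (k + 1 : ℕ) ≤ 2 ^ k := Nat.lt_two_pow_self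
    exact_mod_cast this
  -- geometric series
  have hgeom : ∑ k ∈ Icc 1 Y, y ^ k ≤ y / (1 - y) := by
    have hI : Finset.Icc 1 Y = Finset.Ico 1 (Y + 1) := by
      ext k; simp only [Finset.mem_Icc, Finset.mem_Ico]; omega
    rw [hI]
    have := geom_sum_Ico_le_of_lt_one (m := 1) (n := Y + 1) hy0 hy1
    simpa using this
  -- `y/(1-y) ≤ y (1 + 2y) ≤ 2.05/p`
  have hfrac : y / (1 - y) ≤ y * (1 + 2 * y) := by
    rw [div_le_iff₀ (by linarith)]
    have h3 : 0 ≤ y * y * (1 - 2 * y) := mul_nonneg (mul_nonneg hy0 hy0) (by linarith)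
    have e : y * (1 + 2 * y) * (1 - y) = y + y * y * (1 - 2 * y) := by ring
    rw [e]; linarith
  calc ∑ k ∈ Icc 1 Y, g (p ^ k) ≤ ∑ k ∈ Icc 1 Y, y ^ k := Finset.sum_le_sum hterm
    _ ≤ y * (1 + 2 * y) := hgeom.trans hfrac
    _ ≤ 202 / 100 / p * (1 + 2 * (202 / 100 / 321)) := by gcongr
    _ ≤ 205 / 100 / p := by
        rw [div_mul_eq_mul_div, div_le_div_iff_of_pos_right hp0]
        norm_num

/-! ### One window -/

/-- **The window bound** (Tao–Teräväinen (3.14), repaired and explicit). Let `g ≥ 0` be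
multiplicative with `g(p^k) ≤ (k+1)(p^{-β})^k` (`0 ≤ β ≤ 1`), `q ≥ 3` with `q^{4(1−β)} ≤ 1.01`;
let `0 < a' < a ≤ 4` with `a ≤ 1.1 a'`, `a' log q ≥ 320`, and `m ≥ 2` with `a' m ≥ 4`, `a m ≤ 9`;
assume `∑_{q^4 < N ≤ q^{13}} g(N) ≤ ρ₁ ∑_{n ≤ q^4} g(n)` with `∑_{n ≤ q^4} g(n) > 0`, `ρ₁ ≥ 0`. Then
`∑_{q^{a'} < p ≤ q^{a}} g(p) ≤ m (2ρ₁)^{1/m} + (m − 1) · 2.02 q^{−a'}`.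
[cite: TaoTeravainen2021, §3.3 Proposition 3.5 (3.14)] -/
theorem window_sum_le {g : ArithmeticFunction ℝ} (hg : g.IsMultiplicative) (hg0 : ∀ n, 0 ≤ g n)
    {q : ℕ} (hq3 : 3 ≤ q) {β : ℝ} (hβ1 : β ≤ 1)
    (hgpk : ∀ p k : ℕ, p.Prime → 1 ≤ k → g (p ^ k) ≤ (k + 1 : ℝ) * ((p : ℝ) ^ (-β)) ^ k)
    (hq4β : (q : ℝ) ^ (4 * (1 - β)) ≤ 101 / 100)
    {a a' : ℝ} (ha'0 : 0 < a') (haa' : a' < a) (ha4 : a ≤ 4) (hratio : a ≤ 11 / 10 * a')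
    (ha'L : 320 ≤ a' * Real.log q)
    {m : ℕ} (hm2 : 2 ≤ m) (hlow : 4 ≤ a' * m) (hup : a * m ≤ 9)
    {ρ₁ : ℝ} (hρ₁ : 0 ≤ ρ₁) (hbase : 0 < ∑ n ∈ Icc 1 (q ^ 4), g n)
    (hρ : ∑ N ∈ Ioc (q ^ 4) (q ^ 13), g N ≤ ρ₁ * ∑ n ∈ Icc 1 (q ^ 4), g n) :
    ∑ p ∈ (Nat.primesLE ⌊(q : ℝ) ^ a⌋₊).filter (fun p : ℕ => (q : ℝ) ^ a' < (p : ℝ)), g p ≤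
      m * (2 * ρ₁) ^ (1 / (m : ℝ)) + ((m : ℝ) - 1) * (202 / 100 * (q : ℝ) ^ (-a')) := by
  classical
  -- the window and its primes
  set t : ℝ := (q : ℝ) ^ a with htdef
  set t' : ℝ := (q : ℝ) ^ a' with ht'def
  set W : Finset ℕ := (Nat.primesLE ⌊t⌋₊).filter (fun p : ℕ => t' < (p : ℝ)) with hWdef
  set G4 : ℝ := ∑ n ∈ Icc 1 (q ^ 4), g n with hG4def
  have hq0 : (0 : ℝ) < q := by exact_mod_cast lt_of_lt_of_le (by norm_num) hq3
  have hq1 : (1 : ℝ) < q := by exact_mod_cast lt_of_lt_of_le (by norm_num) hq3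
  have hL0 : 0 < Real.log q := Real.log_pos hq1
  have ht0 : 0 < t := Real.rpow_pos_of_pos hq0 _
  have ht'0 : 0 < t' := Real.rpow_pos_of_pos hq0 _
  have ht't : t' < t := Real.rpow_lt_rpow_of_exponent_lt hq1 haa'
  have hlogt' : Real.log t' = a' * Real.log q := by rw [ht'def, Real.log_rpow hq0]
  have hlogt : Real.log t = a * Real.log q := by rw [htdef, Real.log_rpow hq0]
  have ha0 : 0 < a := by linarith
  -- `t' ≥ 321`
  have ht'big : (321 : ℝ) ≤ t' := by
    have h1 : Real.exp 320 ≤ t' := by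
      have e : Real.exp (Real.log t') = t' := Real.exp_log ht'0
      rw [← e, Real.exp_le_exp, hlogt']
      exact ha'L
    linarith [Real.add_one_le_exp (320 : ℝ)]
  have ht'2 : (2 : ℝ) ≤ t' := by linarith
  have ht4 : t ≤ (q : ℝ) ^ (4 : ℕ) := by
    rw [← Real.rpow_natCast]
    exact Real.rpow_le_rpow_of_exponent_le hq1.le (by exact_mod_cast ha4)
  have hW : ∀ p ∈ W, p.Prime ∧ t' < (p : ℝ) ∧ (p : ℝ) ≤ t := by
    intro p hp
    simp only [hWdef, Finset.mem_filter, Nat.mem_primesLE] at hp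
    exact ⟨hp.1.2, hp.2, (Nat.cast_le.mpr hp.1.1).trans (Nat.floor_le ht0.le)⟩
  have hWprime : ∀ p ∈ W, p.Prime := fun p hp => (hW p hp).1
  -- `p^{-β} ≤ 1.01/p` on the window
  have hpβ : ∀ p ∈ W, (p : ℝ) ^ (-β) ≤ 101 / 100 / p := by
    intro p hp
    obtain ⟨hpp, ht'p, hpt⟩ := hW p hp
    have hp0 : (0 : ℝ) < p := by exact_mod_cast hpp.pos
    have h1 : (p : ℝ) ^ (1 - β) ≤ 101 / 100 := by
      calc (p : ℝ) ^ (1 - β) ≤ ((q : ℝ) ^ (4 : ℕ)) ^ (1 - β) :=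
            Real.rpow_le_rpow hp0.le (hpt.trans ht4) (by linarith)
        _ = (q : ℝ) ^ (4 * (1 - β)) := by
            rw [← Real.rpow_natCast, ← Real.rpow_mul hq0.le]; norm_num
        _ ≤ 101 / 100 := hq4β
    have e : (p : ℝ) ^ (-β) = (p : ℝ) ^ (1 - β) * (p : ℝ)⁻¹ := by
      rw [← Real.rpow_neg_one, ← Real.rpow_add hp0]; ring_nf
    rw [e, div_eq_mul_inv]
    exact mul_le_mul_of_nonneg_right h1 (inv_nonneg.mpr hp0.le)
  -- weights: `0 ≤ g p ≤ wmax = 2.02 q^{-a'}`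
  set wmax : ℝ := 202 / 100 * (q : ℝ) ^ (-a') with hwmaxdef
  have hqa' : (q : ℝ) ^ (-a') = t'⁻¹ := by rw [ht'def, Real.rpow_neg hq0.le]
  have hwmax0 : 0 ≤ wmax := by rw [hwmaxdef]; positivity
  have hgW : ∀ p ∈ W, g p ≤ wmax := by
    intro p hp
    obtain ⟨hpp, ht'p, hpt⟩ := hW p hp
    have hp0 : (0 : ℝ) < p := by exact_mod_cast hpp.pos
    have h1 := hgpk p 1 hpp le_rfl
    simp only [pow_one, Nat.cast_one] at h1
    calc g p ≤ (1 + 1) * (p : ℝ) ^ (-β) := h1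
      _ ≤ 2 * (101 / 100 / p) := by norm_num; linarith [hpβ p hp]
      _ = 202 / 100 * (p : ℝ)⁻¹ := by ring
      _ ≤ 202 / 100 * t'⁻¹ := by gcongr
      _ = wmax := by rw [hwmaxdef, hqa']
  -- Mertens: `∑_{p∈W} 1/p ≤ 0.15`
  have hrecip : ∑ p ∈ W, (p : ℝ)⁻¹ ≤ 15 / 100 := by
    refine (sum_inv_prime_window_le ht'2 ht't.le).trans ?_
    rw [hlogt, hlogt']
    have hlogratio : Real.log (a * Real.log q) - Real.log (a' * Real.log q) ≤ 1 / 10 := by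
      rw [← Real.log_div (by positivity) (by positivity), mul_div_mul_right _ _ hL0.ne']
      have h1 := Real.log_le_sub_one_of_pos (show 0 < a / a' by positivity)
      have h2 : a / a' ≤ 11 / 10 := by rw [div_le_iff₀ ha'0]; linarith
      linarith
    have h3 : 8 / (a * Real.log q) ≤ 8 / (a' * Real.log q) :=
      div_le_div_of_nonneg_left (by norm_num) (by positivity) (by nlinarith)
    have h4 : 8 / (a' * Real.log q) ≤ 8 / 320 := div_le_div_of_nonneg_left (by norm_num) (by norm_num) ha'L
    linarith
  -- the powers of the window primes: `τ ≤ 2.05 · 0.15 < 1/2`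
  have hτ : ∑ p ∈ W, ∑ k ∈ Icc 1 (q ^ 4), g (p ^ k) ≤ 1 / 2 := by
    calc ∑ p ∈ W, ∑ k ∈ Icc 1 (q ^ 4), g (p ^ k) ≤ ∑ p ∈ W, 205 / 100 / (p : ℝ) := by
          refine Finset.sum_le_sum fun p hp => ?_
          obtain ⟨hpp, ht'p, -⟩ := hW p hp
          exact sum_prime_pow_weight_le (q ^ 4) (fun k hk => hgpk p k hpp hk) (by linarith)
            (hpβ p hp)
      _ = 205 / 100 * ∑ p ∈ W, (p : ℝ)⁻¹ := by
          rw [Finset.mul_sum]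
          refine Finset.sum_congr rfl fun p _ => ?_
          ring
      _ ≤ 205 / 100 * (15 / 100) := by gcongr
      _ ≤ 1 / 2 := by norm_num
  -- the base: integers `≤ q^4` free of `W` carry half the weight
  set B : ℝ := ∑ n ∈ (Icc 1 (q ^ 4)).filter (fun n => ∀ p ∈ W, ¬ p ∣ n), g n with hBdef
  have hB : G4 / 2 ≤ B := by
    have h := sum_free_ge hg hg0 hWprime (q ^ 4)
    rw [← hBdef, ← hG4def] at h
    nlinarith [hbase.le]
  have hBpos : 0 < B := by linarith
  -- the `m`-fold products lie in `(q^4, q^13]`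
  have hq1n : 1 ≤ q := by omega
  have hmpos : 0 < m := by omega
  have hcardpos : ∀ P ∈ W.powersetCard m, P.Nonempty := fun P hP =>
    Finset.card_pos.mp (by rw [(Finset.mem_powersetCard.mp hP).2]; exact hmpos)
  have hprod_low : ∀ P ∈ W.powersetCard m, q ^ 4 < ∏ p ∈ P, p := by
    intro P hP
    obtain ⟨hPW, hcard⟩ := Finset.mem_powersetCard.mp hP
    have h1 : ∏ _p ∈ P, t' < ∏ p ∈ P, (p : ℝ) :=
      Finset.prod_lt_prod_of_nonempty (fun p _ => ht'0) (fun p hp => (hW p (hPW hp)).2.1)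
        (hcardpos P hP)
    rw [Finset.prod_const, hcard] at h1
    have h2 : (q : ℝ) ^ (4 : ℕ) ≤ t' ^ m := by
      rw [ht'def, ← Real.rpow_natCast ((q : ℝ) ^ a') m, ← Real.rpow_mul hq0.le,
        ← Real.rpow_natCast]
      exact Real.rpow_le_rpow_of_exponent_le hq1.le (by exact_mod_cast hlow)
    have h3 : ((q ^ 4 : ℕ) : ℝ) < ((∏ p ∈ P, p : ℕ) : ℝ) := by
      push_cast
      exact lt_of_le_of_lt h2 h1
    exact_mod_cast h3
  have hprod_up : ∀ n ∈ Icc 1 (q ^ 4), ∀ P ∈ W.powersetCard m, n * ∏ p ∈ P, p ≤ q ^ 13 := by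
    intro n hn P hP
    obtain ⟨hPW, hcard⟩ := Finset.mem_powersetCard.mp hP
    have h1 : ∏ p ∈ P, (p : ℝ) ≤ ∏ _p ∈ P, t :=
      Finset.prod_le_prod (fun p _ => Nat.cast_nonneg p) (fun p hp => (hW p (hPW hp)).2.2)
    rw [Finset.prod_const, hcard] at h1
    have h2 : t ^ m ≤ (q : ℝ) ^ (9 : ℕ) := by
      rw [htdef, ← Real.rpow_natCast ((q : ℝ) ^ a) m, ← Real.rpow_mul hq0.le,
        ← Real.rpow_natCast]
      exact Real.rpow_le_rpow_of_exponent_le hq1.le (by exact_mod_cast hup)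
    have h3 : ((∏ p ∈ P, p : ℕ) : ℝ) ≤ ((q ^ 9 : ℕ) : ℝ) := by
      push_cast
      exact h1.trans h2
    have h4 : ∏ p ∈ P, p ≤ q ^ 9 := by exact_mod_cast h3
    calc n * ∏ p ∈ P, p ≤ q ^ 4 * q ^ 9 := Nat.mul_le_mul (Finset.mem_Icc.mp hn).2 h4
      _ = q ^ 13 := by rw [← pow_add]
  -- `e_m ≤ 2 ρ₁`
  have hesymm : ∑ P ∈ W.powersetCard m, ∏ p ∈ P, g p ≤ 2 * ρ₁ := by
    have h := sum_free_mul_esymm_le hg hg0 hWprime hprod_low hprod_up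
    rw [← hBdef] at h
    have he0 : 0 ≤ ∑ P ∈ W.powersetCard m, ∏ p ∈ P, g p :=
      Finset.sum_nonneg fun P hP => Finset.prod_nonneg fun p _ => hg0 p
    -- `B e_m ≤ ρ₁ G4 ≤ 2 ρ₁ B`
    have h2 : B * ∑ P ∈ W.powersetCard m, ∏ p ∈ P, g p ≤ B * (2 * ρ₁) := by
      calc B * ∑ P ∈ W.powersetCard m, ∏ p ∈ P, g p ≤ ρ₁ * G4 := h.trans hρ
        _ ≤ ρ₁ * (2 * B) := mul_le_mul_of_nonneg_left (by linarith) hρ₁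
        _ = B * (2 * ρ₁) := by ring
    exact le_of_mul_le_mul_left h2 hBpos
  -- solve for the sum over the window
  have hfinal := sum_le_of_esymm_le (fun p _ => hg0 p) hgW hwmax0 (by positivity)
    (by omega : 1 ≤ m) hesymm
  exact hfinal

end Literature.NumberTheory.LFunctions.SiegelZero

end
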